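import Summits.HubbardSuperconductivity.HubbardSuperconductivity.Theorems.ThermalWedgeTwSeededEnsembleEquivalenceRDiffOfCompressibility

/-!
# Crux `TwSeededEnsembleEquivalenceR` (stmt-HubbardSuperconductivity-15581), line `cold-floor-collapse`
# (slug `Sketch`, skeleton v6/v7) — ENGINE-FACING NORMAL FORM OF THE REGULATED PHYSICS STUB DEEP-DIFF

Support file (`--supports stmt-HubbardSuperconductivity-15581`; sorry-free; no definition).

Skeleton v6 of the line (lead c2) restricts the `μ`-differentiability input to DEEP sources `e^{−a/(4U)} ≤ |h| ≤ 13g+1`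
(`stub_sourcedColdDiffDeep`, DEEP-DIFF): by the floor `stub_optimiserFloor` no other source is ever a maximiser at the
cold slice. As for the whole-box stub (route seat 0, `sdc_stub_sourcedColdDiff_of_compressibility`,
…RDiffOfCompressibility), a constructive expansion delivers a FINITE-VOLUME statement: an `L`-uniform bound on the
symmetric second `μ`-difference of the sourced torus pressure (bounded compressibility), now only at deep sources —
the source-as-infrared-regulator regime `U log(1/|h|) ≤ a/4`, `|h|/T ≥ e^{3a/(4U)}`. This file proves, kernel-checked:

* `sdc_stub_sourcedColdDiffDeep_of_deepCompressibility` — **DEEP-E_DIFF ⟹ DEEP-DIFF** with DEEP-DIFF the registered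
  signature of `stub_sourcedColdDiffDeep` VERBATIM, where DEEP-E_DIFF has the same quantifier prefix and asserts, for
  every `μ ∈ (μ₁,μ₂)` and every DEEP source, `p̃_L(μ+t,h) + p̃_L(μ−t,h) − 2p̃_L(μ,h) ≤ M t²` for `0 < t ≤ t₀` and all large
  `L`. Proof: pointwise in `(μ, h)` the argument of the whole-box bridge (convexity of `p̃_L(·,h)` passes to the limit,
  so does the second-difference bound; `sdc_differentiableAt_of_convexOn_of_second_difference_le`). [folklore composition]
-/

set_option linter.dupNamespace false

namespace Summit.HubbardSuperconductivity.HubbardSuperconductivity.Theorems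

open Matrix Set Filter Topology Literature.MathematicalPhysics.QuantumLattice
open Summit.HubbardSuperconductivity.HubbardSuperconductivity.Theorems.TwSeededEnsembleEquivalence.ThermalDuality
open Summit.HubbardSuperconductivity.HubbardSuperconductivity.Theorems.TwSeededEnsembleEquivalenceR.ColdFloorLine
open scoped ComplexOrder

noncomputable section

/-- **Engine-facing normal form of DEEP-DIFF (`stub_sourcedColdDiffDeep` of line `Sketch`, skeleton v6, crux
stmt-HubbardSuperconductivity-15581).** If, on every compact window `[μ₁,μ₂] ⊂ (−4,0)`, for all small exponents
`a ≤ a₀` (seed floor `K′`, `U ≤ U₀`), every `μ ∈ (μ₁,μ₂)` and every DEEP source `e^{−a/(4U)} ≤ |h| ≤ 13g+1`, the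
finite-volume sourced torus pressure `p̃_L(·,h)` at `β = e^{a/U}` has symmetric second `μ`-differences
`≤ M t²` for `0 < t ≤ t₀` uniformly in large `L` (bounded compressibility at regulated sources), then every pointwise
thermodynamic limit `q(·,h)` on the window is differentiable on `(μ₁,μ₂)` at every deep source — the registered
signature of `stub_sourcedColdDiffDeep`, verbatim. [folklore composition] -/
theorem sdc_stub_sourcedColdDiffDeep_of_deepCompressibility :
    (∀ (μ₁ μ₂ : ℝ), -4 < μ₁ → μ₁ < μ₂ → μ₂ < 0 → ∃ a₀ : ℝ, 0 < a₀ ∧ ∀ a ∈ Set.Ioc (0 : ℝ) a₀,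
      ∃ K' U₀ : ℝ, 0 < K' ∧ 0 < U₀ ∧ ∀ U ∈ Set.Ioc (0 : ℝ) U₀, ∀ g ∈ Set.Icc (K' * U) (1 / 10),
        ∀ μ ∈ Set.Ioo μ₁ μ₂, ∀ h ∈ Set.Icc (-(13 * g + 1)) (13 * g + 1), Real.exp (-(a / (4 * U))) ≤ |h| →
          ∃ M t₀ : ℝ, 0 < t₀ ∧ ∃ L₀ : ℕ, ∀ (L : ℕ) [NeZero L], L₀ ≤ L → ∀ t : ℝ, 0 < t → t ≤ t₀ →
            Real.log (Matrix.partitionFn (Real.exp (a / U)) (dWaveSourceTorus L U (μ + t) h)).re /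
                  (Real.exp (a / U) * (L : ℝ) ^ 2) +
                Real.log (Matrix.partitionFn (Real.exp (a / U)) (dWaveSourceTorus L U (μ - t) h)).re /
                  (Real.exp (a / U) * (L : ℝ) ^ 2) -
              2 * (Real.log (Matrix.partitionFn (Real.exp (a / U)) (dWaveSourceTorus L U μ h)).re /
                  (Real.exp (a / U) * (L : ℝ) ^ 2)) ≤ M * t ^ 2) →
    ∀ (μ₁ μ₂ : ℝ), -4 < μ₁ → μ₁ < μ₂ → μ₂ < 0 → ∃ a₀ : ℝ, 0 < a₀ ∧ ∀ a ∈ Set.Ioc (0 : ℝ) a₀,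
      ∃ K' U₀ : ℝ, 0 < K' ∧ 0 < U₀ ∧ ∀ U ∈ Set.Ioc (0 : ℝ) U₀, ∀ g ∈ Set.Icc (K' * U) (1 / 10),
        ∀ q : ℝ → ℝ → ℝ,
          (∀ μ ∈ Set.Icc μ₁ μ₂, ∀ h ∈ Set.Icc (-(13 * g + 1)) (13 * g + 1), ∀ κ : ℝ, 0 < κ →
            ∃ L₀ : ℕ, ∀ (L : ℕ) [NeZero L], L₀ ≤ L →
              |Real.log (Matrix.partitionFn (Real.exp (a / U)) (dWaveSourceTorus L U μ h)).re /
                  (Real.exp (a / U) * (L : ℝ) ^ 2) - q μ h| ≤ κ) →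
          ∀ μ ∈ Set.Ioo μ₁ μ₂, ∀ h ∈ Set.Icc (-(13 * g + 1)) (13 * g + 1),
            Real.exp (-(a / (4 * U))) ≤ |h| → DifferentiableAt ℝ (fun μ' => q μ' h) μ := by
  intro hE μ₁ μ₂ h4 h12 h0
  obtain ⟨a₀, ha₀, hA⟩ := hE μ₁ μ₂ h4 h12 h0
  refine ⟨a₀, ha₀, fun a ha => ?_⟩
  obtain ⟨K', U₀, hK', hU₀, hB⟩ := hA a ha
  refine ⟨K', U₀, hK', hU₀, fun U hU g hg q hq μ hμ h hh hdeep => ?_⟩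
  obtain ⟨M, t₀, ht₀, L₀, hL₀⟩ := hB U hU g hg μ hμ h hh hdeep
  set β : ℝ := Real.exp (a / U) with hβ_def
  have hβ : 0 < β := Real.exp_pos _
  -- sequence form (side `n + 1`) of the finite-volume pressures at the fixed source `h`
  set P : ℕ → ℝ → ℝ := fun n μ' =>
    Real.log (partitionFn β (dWaveSourceTorus (n + 1) U μ' h)).re / (β * ((n + 1 : ℕ) : ℝ) ^ 2)
    with hP_def
  have hseq : ∀ μ' ∈ Set.Icc μ₁ μ₂, ∀ κ : ℝ, 0 < κ → ∃ N : ℕ, ∀ n, N ≤ n → |P n μ' - q μ' h| ≤ κ := by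
    intro μ' hμ' κ hκ
    obtain ⟨L₁, hL₁⟩ := hq μ' hμ' h hh κ hκ
    exact ⟨L₁, fun n hn => hL₁ (n + 1) (by omega)⟩
  -- convexity of the limit on the window
  have hconv : ConvexOn ℝ (Set.Icc μ₁ μ₂) (fun μ' => q μ' h) := by
    refine bdl_convexOn_of_limit (convex_Icc μ₁ μ₂) P (fun μ' => q μ' h) (fun n => ?_) hseq
    exact (cfb_convexOn_sourcedPressure (n + 1) U h hβ).subset (Set.subset_univ _) (convex_Icc μ₁ μ₂)
  -- second-difference bound for the limit at `μ`, for `0 < t ≤ t₁`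
  set t₁ : ℝ := min t₀ (min (μ₂ - μ) (μ - μ₁)) with ht₁_def
  have ht₁ : 0 < t₁ := by
    simp only [ht₁_def, lt_min_iff]
    exact ⟨ht₀, by linarith [hμ.2], by linarith [hμ.1]⟩
  have h2 : ∀ t : ℝ, 0 < t → t ≤ t₁ →
      q (μ + t) h + q (μ - t) h - 2 * q μ h ≤ M * t ^ 2 := by
    intro t ht htt
    have htt₀ : t ≤ t₀ := htt.trans (min_le_left _ _)
    have ht2 : t ≤ μ₂ - μ := htt.trans ((min_le_right _ _).trans (min_le_left _ _))
    have ht1 : t ≤ μ - μ₁ := htt.trans ((min_le_right _ _).trans (min_le_right _ _))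
    have hp : μ + t ∈ Set.Icc μ₁ μ₂ := ⟨by linarith [hμ.1], by linarith⟩
    have hm : μ - t ∈ Set.Icc μ₁ μ₂ := ⟨by linarith, by linarith [hμ.2]⟩
    have h0' : μ ∈ Set.Icc μ₁ μ₂ := ⟨hμ.1.le, hμ.2.le⟩
    refine sdc_add_sub_two_mul_le_of_limits (hseq _ hp) (hseq _ hm) (hseq _ h0') ⟨L₀, fun n hn => ?_⟩
    exact hL₀ (n + 1) (by omega) t ht htt₀
  have hint : μ ∈ interior (Set.Icc μ₁ μ₂) := by
    rw [interior_Icc]; exact hμ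
  exact sdc_differentiableAt_of_convexOn_of_second_difference_le hconv hint ht₁ h2

end

end Summit.HubbardSuperconductivity.HubbardSuperconductivity.Theorems
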